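import Literature.NumberTheory.EllipticCurves.DeShalit1987.KatzMeasureJZero
import HarnessLib

set_option autoImplicit false

/-!
# The (49)–(50) interpolation range as a PARAMETER of the receptacles on the lower path at `p = 2`:
# `IsLMeasureOn R`, `IsKatzDistribution₂On R`, the corner `RJ0 m j := j = 0 ∧ 3 ≤ m`, and their
# identification with de Shalit's `j = 0` twins `IsLMeasure₀` / `IsKatzDistribution₂₀`

de Shalit 1987, II Thm. 4.14 (36) (p. 71) / II.4.16 (49)–(50) (p. 76–77) interpolate `L(ε⁻¹, 0)` for `ε` of
type `(−m, j)`, `0 ≤ j < m`; the tree types this as `DeShalit1987.IsLMeasure` (measure on `Γ_K`) and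
`DeShalit1987.IsKatzDistribution₂` (its push-forward to `ℤ_p²`, II.4.17 (54)), and the `j = 0`, `3 ≤ m` slice
(Thm. 4.12 (31), p. 66–67) as the twins `DeShalit1987.IsLMeasure₀` / `DeShalit1987.IsKatzDistribution₂₀`
(`Literature/…/DeShalit1987/KatzMeasureJZero.lean`).

This file makes the RANGE a parameter `R : ℕ → ℕ → Prop` of both predicates — scaffolding only, so that
the two extreme instances are identified BY NAME and every range-uniform argument is written once:

* §0 the key-parametric handshake (pure logic): a consumer reading the interpolation predicate only as the
  KEY shared by an `∃`-hypothesis and a `∀`-hypothesis concludes for ANY key (`concl_of_keyed_handshake`);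
  re-keying the `∀`-side on a weaker key is a stronger hypothesis (`forall_key_anti`), re-keying the `∃`-side
  is free (`exists_key_mono`).
* §1 `IsLMeasureOn R` (verbatim `IsLMeasure` with the binder `R m j →`), ANTITONE in `R`;
  `R := ⊤` ⟺ `IsLMeasure` (`isLMeasure_iff_isLMeasureOn_top`); the corner `RJ0`; and
  ★ `isLMeasureOn_RJ0_iff_isLMeasure₀` — the `RJ0`-slice IS the twin `IsLMeasure₀`.
* §2 `IsKatzDistribution₂On R` (verbatim `IsKatzDistribution₂` with `R m j →`); `R := ⊤` ⟺ the tree's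
  predicate; ★ `isKatzDistribution₂On_RJ0_iff_isKatzDistribution₂₀` — the `RJ0`-slice IS the twin; and
  `IsLMeasureOn.isKatzDistribution₂On` — the transport II.4.17 (54) is POINTWISE in the range point, proved
  once for every `R` by the tree's proof of `IsLMeasure.isKatzDistribution₂` (at `R := RJ0` it is the twin's
  `IsLMeasure₀.isKatzDistribution₂₀`, `isKatzDistribution₂On_RJ0_of_isLMeasure₀`).

Every `def` is a predicate with explicit binders (nothing is asserted); every `theorem` is proved; no named
fact, no instance, no notation.

## References

* [deShalit1987] E. de Shalit, *Iwasawa theory of elliptic curves with complex multiplication* (1987):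
  II Thm. 4.12 (31) (p. 66–67), II Thm. 4.14 (36) (p. 71), II.4.16 (49)–(50) (p. 76–77), II.4.17 (54) (p. 78).
* [Rubin1991] K. Rubin, Invent. Math. 103 (1991), §4 Thm. 4.1 (the consumer of the two-variable key).
-/

noncomputable section

open scoped Classical
open NumberField IsDedekindDomain Field
open Literature.NumberTheory.GaloisRepresentations
open Literature.NumberTheory.EllipticCurves
open Literature.NumberTheory.EllipticCurves.DeShalit1987

namespace Summit.BirchSwinnertonDyer.Rank1Residual.P2.RangeCut

/-! ## §0 The key-parametric handshake -/

section Handshake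

variable {α : Type*} {Key Key₀ Good MC : α → Prop} {C : Prop}

/-- **The consumer reads the Katz predicate only as a KEY**: from `hR : ∃ g, Key g ∧ Good g` (R∃, the value in
existence form), `hMCall : ∀ g, Key g → MC g` (MC⁻ keyed on the SAME predicate) and the key-free glue
`MC g → Good g → C`, the conclusion follows — for ANY `Key` (the shape of the proof term of
`Theorems.PrintCf2.RubinValueTwoLower.lower_two_of_DGal_of_subsetForall_of_katzValueExists`,
`hMC := hMCall Ω δ Ωp G₂ hΩ hδ hG₂`). -/
theorem concl_of_keyed_handshake (hR : ∃ g, Key g ∧ Good g) (hMCall : ∀ g, Key g → MC g)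
    (hglue : ∀ g, MC g → Good g → C) : C := by
  obtain ⟨g, hk, hg⟩ := hR
  exact hglue g (hMCall g hk) hg

/-- Re-keying the `∀`-side on a WEAKER key `Key₀ ⊇ Key` (e.g. the `j = 0` slice) is a STRONGER hypothesis. -/
theorem forall_key_anti (hK : ∀ g, Key g → Key₀ g) (h : ∀ g, Key₀ g → MC g) : ∀ g, Key g → MC g :=
  fun g hg ↦ h g (hK g hg)

/-- Re-keying the `∃`-side on a weaker key is free. -/
theorem exists_key_mono (hK : ∀ g, Key g → Key₀ g) (h : ∃ g, Key g ∧ Good g) : ∃ g, Key₀ g ∧ Good g := by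
  obtain ⟨g, hk, hg⟩ := h
  exact ⟨g, hK g hk, hg⟩

/-- **The `j = 0` handshake**: with BOTH sides keyed on the weaker key the conclusion follows (the `j = 0`
existence statement supplies `hR₀`; the price is `hMCall₀`, the `∀`-side keyed on the `j = 0` predicate). -/
theorem concl_of_keyed_handshake₀ (hR₀ : ∃ g, Key₀ g ∧ Good g) (hMCall₀ : ∀ g, Key₀ g → MC g)
    (hglue : ∀ g, MC g → Good g → C) : C :=
  concl_of_keyed_handshake hR₀ hMCall₀ hglue

end Handshake

/-! ## §1 de Shalit's (49)–(50) with the interpolation range CUT to `R` -/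

section LMeasure

variable {p : ℕ} [Fact p.Prime] {K : Type} [Field K] [NumberField K]

/-- **(49)–(50) on the sub-range `R`**: verbatim `DeShalit1987.IsLMeasure` with the extra binder `R m j →`.
`R := fun _ _ ↦ True` is the tree's predicate; `R := RJ0` is the twin `IsLMeasure₀`.  A predicate on
`μ` — nothing is asserted. [cite: deShalit1987, II.4.16 (49)–(50) (p. 76–77)] -/
def IsLMeasureOn (R : ℕ → ℕ → Prop) (ι : PadicAlgCl p ≃+* ℂ) (v vbar : HeightOneSpectrum (𝓞 K))
    (S : Finset (HeightOneSpectrum (𝓞 K))) (Ω δ : ℂ) (Ωp : ℂ_[p])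
    (𝒰 : SubgroupTower (absoluteGaloisGroup K)) (μ : GroupDistribution 𝒰 ℂ_[p]) : Prop :=
  ∀ (ε : HeckeCharacter K) (e : FramedGaloisRep K (PadicAlgCl p) 1) (m j : ℕ), R m j →
    IsPAdicAvatarOutside S ι ε e → j < m →
    ε.HasInfinityType (fun _ ↦ -(m : ℤ)) (fun _ ↦ (j : ℤ)) →
    (∀ w : HeightOneSpectrum (𝓞 K), w ∉ S → w ≠ vbar → ε.IsUnramifiedAt w) →
    𝒰.IsTowerContinuous (fun σ ↦ avatarValueAt e σ) →
    ∀ hL : LFunction.HasEntireContinuation (heckeLFunction ε),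
      μ.integral (fun σ ↦ avatarValueAt e σ) =
        ((ι.symm (DeShalit1987.interpolationValue p v vbar S ε m j Ω δ (hL.continuation 0)) :
            PadicAlgCl p) : ℂ_[p]) * Ωp ^ (m + j)

/-- **The extremal corner `j = 0`, `3 ≤ m`** — the range of the twins `IsLMeasure₀` / `IsKatzDistribution₂₀` /
`IsKatzMeasure₂₀` (critical type `(−m, 0)`, de Shalit II Thm. 4.12 (31) itself, no `D`-operator).
[cite: deShalit1987, II Thm. 4.12 (31) (p. 66–67)] -/
def RJ0 : ℕ → ℕ → Prop := fun m j ↦ j = 0 ∧ 3 ≤ m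

variable {ι : PadicAlgCl p ≃+* ℂ} {v vbar : HeightOneSpectrum (𝓞 K)} {S : Finset (HeightOneSpectrum (𝓞 K))}
  {Ω δ : ℂ} {Ωp : ℂ_[p]} {𝒰 : SubgroupTower (absoluteGaloisGroup K)} {μ : GroupDistribution 𝒰 ℂ_[p]}

/-- `IsLMeasureOn` is ANTITONE in the range. [cite: deShalit1987, II.4.16 (49)–(50) (p. 76–77)] -/
theorem IsLMeasureOn.anti {R R' : ℕ → ℕ → Prop} (hRR' : ∀ m j, R m j → R' m j)
    (h : IsLMeasureOn R' ι v vbar S Ω δ Ωp 𝒰 μ) : IsLMeasureOn R ι v vbar S Ω δ Ωp 𝒰 μ :=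
  fun ε e m j hR ↦ h ε e m j (hRR' m j hR)

/-- The full predicate gives every slice. [cite: deShalit1987, II.4.16 (49)–(50) (p. 76–77)] -/
theorem isLMeasureOn_of_isLMeasure (R : ℕ → ℕ → Prop) (h : IsLMeasure ι v vbar S Ω δ Ωp 𝒰 μ) :
    IsLMeasureOn R ι v vbar S Ω δ Ωp 𝒰 μ :=
  fun ε e m j _ ↦ h ε e m j

/-- `R := ⊤` IS the tree's predicate. [cite: deShalit1987, II.4.16 (49)–(50) (p. 76–77)] -/
theorem isLMeasure_iff_isLMeasureOn_top :
    IsLMeasure ι v vbar S Ω δ Ωp 𝒰 μ ↔ IsLMeasureOn (fun _ _ ↦ True) ι v vbar S Ω δ Ωp 𝒰 μ :=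
  ⟨isLMeasureOn_of_isLMeasure _, fun h ε e m j ↦ h ε e m j trivial⟩


/-- ★ **The `RJ0`-slice IS the twin `IsLMeasure₀`** (instantiate `j := 0`; conversely the binder `R m j`
forces `j = 0`). [cite: deShalit1987, II Thm. 4.12 (31) (p. 66–67), II.4.16 (49)–(50) (p. 76–77)] -/
theorem isLMeasureOn_RJ0_iff_isLMeasure₀ :
    IsLMeasureOn RJ0 ι v vbar S Ω δ Ωp 𝒰 μ ↔ IsLMeasure₀ ι v vbar S Ω δ Ωp 𝒰 μ := by
  constructor
  · intro h ε e m hav hm hinf hunr hcont hL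
    simpa using h ε e m 0 ⟨rfl, hm⟩ hav (by omega) (by simpa using hinf) hunr hcont hL
  · intro h ε e m j hR hav _ hinf hunr hcont hL
    obtain ⟨rfl, hm⟩ := hR
    simpa using h ε e m hav hm (by simpa using hinf) hunr hcont hL

/-- The twin gives the `RJ0`-slice (the direction consumers use). [cite: deShalit1987, II Thm. 4.12 (31) (p. 66–67)] -/
theorem isLMeasureOn_RJ0_of_isLMeasure₀ (h : IsLMeasure₀ ι v vbar S Ω δ Ωp 𝒰 μ) :
    IsLMeasureOn RJ0 ι v vbar S Ω δ Ωp 𝒰 μ :=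
  isLMeasureOn_RJ0_iff_isLMeasure₀.mpr h

/-- The full predicate gives the twin through the slice (agrees with the tree's `IsLMeasure.isLMeasure₀`).
[cite: deShalit1987, II Thm. 4.14 (36) (p. 71), II Thm. 4.12 (31) (p. 66–67)] -/
theorem isLMeasure₀_of_isLMeasure' (h : IsLMeasure ι v vbar S Ω δ Ωp 𝒰 μ) : IsLMeasure₀ ι v vbar S Ω δ Ωp 𝒰 μ :=
  isLMeasureOn_RJ0_iff_isLMeasure₀.mp (isLMeasureOn_of_isLMeasure RJ0 h)

end LMeasure

/-! ## §2 The transport to `ℤ_p²` is POINTWISE in the range point -/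

section Transport

variable {p : ℕ} [Fact p.Prime] {K : Type} [Field K] [NumberField K]

/-- **(49)–(50) on the `ℤ_p²`-quotient, range cut to `R`**: verbatim `DeShalit1987.IsKatzDistribution₂` with `R m j →`.
A predicate on `D` — nothing is asserted. [cite: deShalit1987, II.4.16 (49)–(50) (p. 76–77), II.4.17 (54) (p. 78)] -/
def IsKatzDistribution₂On (R : ℕ → ℕ → Prop) (ι : PadicAlgCl p ≃+* ℂ) (v vbar : HeightOneSpectrum (𝓞 K))
    (S : Finset (HeightOneSpectrum (𝓞 K))) (κ₁ κ₂ : ZpExtension K p) (lam : HeckeCharacter K)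
    (Ω δ : ℂ) (Ωp : ℂ_[p]) (D : BoundedDistribution (padicIntSq p) ℂ_[p]) : Prop :=
  ∀ (ρ : HeckeCharacter K) (r : FramedGaloisRep K (PadicAlgCl p) 1) (m j : ℕ), R m j →
    IsPAdicAvatarOf ι ρ r → FactorsThroughPair κ₁ κ₂ r → j < m →
    (lam * ρ).HasInfinityType (fun _ ↦ -(m : ℤ)) (fun _ ↦ (j : ℤ)) →
    (∀ w : HeightOneSpectrum (𝓞 K), w ∉ S → w ≠ vbar → (lam * ρ).IsUnramifiedAt w) →
    ∀ (hL : LFunction.HasEntireContinuation (heckeLFunction (lam * ρ)))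
      (F : ℤ_[p] × ℤ_[p] → ℂ_[p]), (∀ σ, F (ZpExtension.pairCoord κ₁ κ₂ σ) = avatarValueAt r σ) →
      D.integral F =
        ((ι.symm (DeShalit1987.interpolationValue p v vbar S (lam * ρ) m j Ω δ (hL.continuation 0)) :
            PadicAlgCl p) : ℂ_[p]) * Ωp ^ (m + j)

variable {ι : PadicAlgCl p ≃+* ℂ} {v vbar : HeightOneSpectrum (𝓞 K)} {S : Finset (HeightOneSpectrum (𝓞 K))}
  {κ₁ κ₂ : ZpExtension K p} {lam : HeckeCharacter K} {Ω δ : ℂ} {Ωp : ℂ_[p]}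
  {𝒰 : SubgroupTower (absoluteGaloisGroup K)} {μ : GroupDistribution 𝒰 ℂ_[p]}
  {D : BoundedDistribution (padicIntSq p) ℂ_[p]}

/-- The full predicate gives every slice. [cite: deShalit1987, II.4.16 (49)–(50) (p. 76–77), II.4.17 (54) (p. 78)] -/
theorem isKatzDistribution₂On_of_isKatzDistribution₂ (R : ℕ → ℕ → Prop)
    (h : IsKatzDistribution₂ ι v vbar S κ₁ κ₂ lam Ω δ Ωp D) : IsKatzDistribution₂On R ι v vbar S κ₁ κ₂ lam Ω δ Ωp D :=
  fun ρ r m j _ ↦ h ρ r m j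

/-- `R := ⊤` IS the tree's predicate. [cite: deShalit1987, II.4.16 (49)–(50) (p. 76–77), II.4.17 (54) (p. 78)] -/
theorem isKatzDistribution₂_iff_on_top :
    IsKatzDistribution₂ ι v vbar S κ₁ κ₂ lam Ω δ Ωp D ↔
      IsKatzDistribution₂On (fun _ _ ↦ True) ι v vbar S κ₁ κ₂ lam Ω δ Ωp D :=
  ⟨isKatzDistribution₂On_of_isKatzDistribution₂ _, fun h ρ r m j ↦ h ρ r m j trivial⟩

/-- ★ **THE TRANSPORT IS POINTWISE IN THE RANGE POINT**: `IsLMeasureOn R` on `Γ_K` gives `IsKatzDistribution₂On R`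
for the SAME `R` on the push-forward of `l·μ` to `ℤ_p²` — the tree's proof of `IsLMeasure.isKatzDistribution₂`
VERBATIM with `R m j` threaded (it instantiates (49)–(50) at `ε = λρ` of the SAME type `(−m, j)`); at `R := RJ0`
it is the twin's `IsLMeasure₀.isKatzDistribution₂₀` (`isKatzDistribution₂On_RJ0_of_isLMeasure₀`).
[cite: deShalit1987, II.4.16 (49)–(50) (p. 76–77), II.4.17 (54) (p. 78)] -/
theorem IsLMeasureOn.isKatzDistribution₂On {R : ℕ → ℕ → Prop}
    (hμ : IsLMeasureOn R ι v vbar S Ω δ Ωp 𝒰 μ)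
    (hU : ∀ n, IsOpen (𝒰.U n : Set (absoluteGaloisGroup K)))
    (hN : ⋂ n, (𝒰.U n : Set (absoluteGaloisGroup K)) ⊆ DeShalit1987.rayKer K p S)
    (hvbar : ((p : ℕ) : 𝓞 K) ∈ vbar.asIdeal)
    {l : FramedGaloisRep K (PadicAlgCl p) 1} (hl : IsPAdicAvatarOutside S ι lam l)
    (hlam : ∀ w : HeightOneSpectrum (𝓞 K), w ∉ S → ((p : ℕ) : 𝓞 K) ∉ w.asIdeal → lam.IsUnramifiedAt w)
    (hind : κ₁.IsIndependent κ₂) :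
    IsKatzDistribution₂On R ι v vbar S κ₁ κ₂ lam Ω δ Ωp
      (katzDistribution₂ μ (DeShalit1987.isTowerContinuous_pairCoord κ₁ κ₂ hU hN) l
        (DeShalit1987.isTowerContinuous_avatarValueAt hl hlam hU hN)) := by
  intro ρ r m j hR hr hκ hjm hinf hunr hL F hF
  have hFeq : F = ZpExtension.pairChar hind r := ZpExtension.eq_pairChar_of_forall_apply_pairCoord hind hκ hF
  have hFc : UniformContinuous F := by
    rw [hFeq]
    exact CompactSpace.uniformContinuous_of_continuous (ZpExtension.continuous_pairChar hind hκ)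
  have hF1 : ∀ x, ‖F x‖ ≤ 1 := fun x ↦ by
    obtain ⟨σ, rfl⟩ := ZpExtension.pairCoord_surjective hind x
    rw [hF]
    exact (norm_avatarValueAt_eq_one r σ).le
  have hunr' : ∀ w : HeightOneSpectrum (𝓞 K), w ∉ S → ((p : ℕ) : 𝓞 K) ∉ w.asIdeal →
      (lam * ρ).IsUnramifiedAt w :=
    fun w hwS hwp ↦ hunr w hwS fun h ↦ hwp (h ▸ hvbar)
  have hav : IsPAdicAvatarOutside S ι (lam * ρ) (FramedRep.twist r (detChar l)) :=
    hr.mul_twist_outside hl hlam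
  have htc : 𝒰.IsTowerContinuous (fun σ ↦ avatarValueAt (FramedRep.twist r (detChar l)) σ) :=
    DeShalit1987.isTowerContinuous_avatarValueAt hav hunr' hU hN
  rw [integral_katzDistribution₂ μ _ l _ hFc hF1, ← hμ (lam * ρ) _ m j hR hav hjm hinf hunr htc hL]
  exact μ.integral_congr fun σ ↦ by rw [hF, avatarValueAt_twist_detChar, mul_comm]


/-- ★ **The `RJ0`-slice IS the twin `IsKatzDistribution₂₀`**. [cite: deShalit1987, II Thm. 4.12 (31) (p. 66–67), II.4.16 (49)–(50) (p. 76–77), II.4.17 (54) (p. 78)] -/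
theorem isKatzDistribution₂On_RJ0_iff_isKatzDistribution₂₀ :
    IsKatzDistribution₂On RJ0 ι v vbar S κ₁ κ₂ lam Ω δ Ωp D ↔
      IsKatzDistribution₂₀ ι v vbar S κ₁ κ₂ lam Ω δ Ωp D := by
  constructor
  · intro h ρ r m hr hκ hm hinf hunr hL F hF
    simpa using h ρ r m 0 ⟨rfl, hm⟩ hr hκ (by omega) (by simpa using hinf) hunr hL F hF
  · intro h ρ r m j hR hr hκ _ hinf hunr hL F hF
    obtain ⟨rfl, hm⟩ := hR
    simpa using h ρ r m hr hκ hm (by simpa using hinf) hunr hL F hF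

/-- At `R := RJ0` the transport is the twin's, BY NAME (`IsLMeasure₀.isKatzDistribution₂₀` through the two
identifications). [cite: deShalit1987, II.4.16 (49)–(50) (p. 76–77), II.4.17 (54) (p. 78)] -/
theorem isKatzDistribution₂On_RJ0_of_isLMeasure₀
    (hμ : IsLMeasure₀ ι v vbar S Ω δ Ωp 𝒰 μ)
    (hU : ∀ n, IsOpen (𝒰.U n : Set (absoluteGaloisGroup K)))
    (hN : ⋂ n, (𝒰.U n : Set (absoluteGaloisGroup K)) ⊆ DeShalit1987.rayKer K p S)
    (hvbar : ((p : ℕ) : 𝓞 K) ∈ vbar.asIdeal)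
    {l : FramedGaloisRep K (PadicAlgCl p) 1} (hl : IsPAdicAvatarOutside S ι lam l)
    (hlam : ∀ w : HeightOneSpectrum (𝓞 K), w ∉ S → ((p : ℕ) : 𝓞 K) ∉ w.asIdeal → lam.IsUnramifiedAt w)
    (hind : κ₁.IsIndependent κ₂) :
    IsKatzDistribution₂On RJ0 ι v vbar S κ₁ κ₂ lam Ω δ Ωp
      (katzDistribution₂ μ (DeShalit1987.isTowerContinuous_pairCoord κ₁ κ₂ hU hN) l
        (DeShalit1987.isTowerContinuous_avatarValueAt hl hlam hU hN)) :=
  isKatzDistribution₂On_RJ0_iff_isKatzDistribution₂₀.mpr (hμ.isKatzDistribution₂₀ hU hN hvbar hl hlam hind)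

end Transport

end Summit.BirchSwinnertonDyer.Rank1Residual.P2.RangeCut

end
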